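import Mathlib
import HarnessLib
import HarnessLib.Audit
import Summits.KontsevichZagierPeriods.Statement
import HarnessLib.Audit.Status.Attr

/-!
Route: FermatIsogeny

DORMANT since 2026-08-25T07:13:51Z (reconciler: no traction for 7.5 d (last activity item-evidence-added at 2026-08-17T19:04:49Z); parked, not closed — `ledger route dormant route-KontsevichZagierPeriods-FermatIsogeny --off` to reactiva) — unstaffed, not closed; items shared with open routes are served there. `ledger route dormant <id> --off` reactivates.

Route FermatIsogeny (card riemann-bilinear-unnesting-triplication-isogeny). The card has two
DEVICES: triplication-by-isogeny (TRI), run by this route, and Riemann-bilinear un-nesting (RB), run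
by route UnfoldedStokes — a division of mechanisms between routes, NOT of the summit statement: this
route's cruxes 3, 4, 5 cover the entire statement KontsevichZagierPeriods (deciding theorem
`closes`, see rationale).

THESIS X (it suffices to show X): X := BetaLinearSector ∧ BetaProductSector ∧ FermatSectorComplete —
the conjunction of cruxes 3, 4, 5 (rev 5: no separate target decl; the rev ≤ 4 target
FermatSectorThesis = BetaLinearSector ∧ BetaProductSector, the sector alone, is dropped together
with SummitOffFermatSector).
SECTOR PART (cruxes 3–4, where this line's mechanism works): Conjecture 1 of Kontsevich–Zagier holds
for every pair
(beta representation ∫_0^1 x^{a-1}(1-x)^{b-1} dx, algebraic multiple of another one) in dimension 1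
and for every pair
(product of two beta representations on (0,1)^2, algebraic multiple of another such product) in
dimension 2 (a, b, ... positive rationals).
COMPLEMENT PART (crux 5, FermatSectorComplete = relative completeness of the KZ calculus modulo that
sector): any two representations of
KZ's §1.1 shape with equal value are connected in the calculus ENLARGED by the beta-sector pairs as
extra axioms,
[r] − [r'] ∈ KZ.relations ⊔ closure(beta-linear pairs ∪ beta-product pairs). It is the off-sector
complement of the summit, ranked last:
the route encompasses the entire summit (D-0027 §2.1; route-choice 2026-08-16, option (a)), and X →
KontsevichZagierPeriods is pure
lattice logic (the sector statements say closure(beta pairs) ≤ relations; sup_le) — this is the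
deciding theorem `closes`.
Mechanism for the sector (by tool): (LIN) every Q̄-linear relation among 1-periods of Fermat curves
is the shadow of a Koblitz–Rohrlich
unit-orbit isogeny hH_{r,s,t} = H_{r',s',t'} between factors of J(F_N) [KoblitzRohrlich1978 p.1184,
Thms 1–4; WolfartWustholz1985;
HuberWustholz2022], to be compiled into moves as correspondence SHEETS (rule 2 on injectivity cells
of the two finite projections of an
explicit divisor D on F_N x F_N) plus EXACT forms (rule 3 with ALGEBRAIC primitives: D^*omega =
c.omega' + dF) plus Green on planar
semialgebraic cells of F_N(C) in R^4 (closed forms, algebraic coefficients); (PROD) every product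
relation is (LIN) tensor Dirichlet
re-association B(a,b)B(a+b,c) = B(a,b+c)B(b,c) — two rule-2 moves through the Fermat surface's
Dirichlet simplex [AndrewsAskeyRoy1999 Thm 1.8.1] —
tensor reflection B(a,1-a) = pi/sin(pi a) (the d <= 1 rational sector of route LowDimension).
First instance and kill switch: the tree's most informative pair, Gauss triplication 0312,
B(1/9,4/9)B(5/9,7/9) = 2.3^{7/6}.pi, is
EXACTLY (i) IsogenyLinearNinth: B(5/9,7/9) = (8/3).3^{1/6}.sin(pi/9).B(8/9,5/9) — one Q̄-linear
relation between two 1-dim reps, induced by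
the UNIQUE non-obvious isogeny L_{1,1,7} ~ L_{3,1,5} of J(F_9) [KoblitzRohrlich1978 Thm 3, N = 3^2,
m = 0; H_{1,4,4} = {1,5,7}, H_{5,7,6} = {2,4,8} = 8.{1,5,7}],
(ii) DirichletNinth: B(1/9,4/9)B(8/9,5/9) = (9/4)B(1/9,8/9) (5 moves on paper), (iii)
ReflectionNinth: sin(pi/9).B(1/9,8/9) = pi
(rational 1-dim sector; = route CompiledSubstitutions' EulerReflectionRational at a = 1/9), glued by
the proved product/ideal
structure of KZ.relations (KZProductIdeal: Equivalent.prod, mul_mem_relations_left/right_holds,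
of_sub_of_reindex_mem_relations).
All values checked numerically to 1e-14 (opening session). The card's RB device (un-nesting) is
pursued by route UnfoldedStokes (mechanism division only; the statement coverage of this route stays
entire through crux 5).

Lean (route file decls, all elaborate; rev 5, planner Sketch.lean rc 0, axioms
propext/Classical.choice/Quot.sound):
  Crux 5      FermatSectorComplete := ∀ ⦃n m⦄ (r : KZ.IntegralRep n) (r' : KZ.IntegralRep m),
r.IsRational → r'.IsRational → r.value = r'.value →
              KZ.of r − KZ.of r' ∈ KZ.relations ⊔ AddSubgroup.closure (S_lin ∪ S_prod), S_lin /
S_prod = the formal differences [ρ] − [ρ'] of the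
              hypothesis pairs of BetaLinearSector / BetaProductSector (inlined); implied by the
summit (relations ≤ relations ⊔ _, one line)
  Assembly    BetaLinearSector → BetaProductSector → FermatSectorComplete → KontsevichZagierPeriods
(provable now: the body of `closes`)
  closes      (h₃ : BetaLinearSector) (h₄ : BetaProductSector) (h₅ : FermatSectorComplete) :
KontsevichZagierPeriods :=
              sup_le le_rfl (closure_le.2 ⟨pairs of S_lin ↦ h₃, pairs of S_prod ↦ h₄⟩) applied to h₅
r r'
(rev 5 replaces the rev-2–4 bare implication SummitOffFermatSector := FermatSectorThesis →
KontsevichZagierPeriods, which became vacuous should a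
sector crux be refuted, by the contentful crux FermatSectorComplete and drops the sector-only target
FermatSectorThesis with it — the idiom of MotivatedMoves.GammaSectorComplete /
GammaCornerAnomaly.MUMSectorComplete; IsogenyLinearNinth leaves the glue because it is an instance
of BetaLinearSector not used by the
implication, and stays the rank-2 kill switch that, with the supports, yields TriplicationAccessible
through TriplicationGlue).

Rationale: WHY THIS LINE. Route Neg bets that the Gauss-triplication pair 0312 is NOT KZ-equivalent because its
known proofs detour through Gamma
(an exponential period) or through Hodge classes on the degree-9 Fermat SURFACE
[Deligne1982HodgeCycles §7; Shioda1979; Aoki1987]. This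
route imports the CM theory of Fermat Jacobians (Shimura–Taniyama via KoblitzRohrlich1978; Gross1978
with Rohrlich's appendix: periods
of F_N are beta values) and transcendence (WolfartWustholz1985, HuberWustholz2022: Q̄-linear
relations of 1-periods are motivic) to LOWER
THE DIMENSION: after two Dirichlet moves and the reflection chain, 0312 is ONE Q̄-linear relation
between two 1-dim beta reps, the
period shadow of the unique non-obvious isogeny L_{1,1,7} ~ L_{3,1,5} of J(F_9) (KoblitzRohrlich1978
Thm 3 at N = 9; CM types
{1,5,7} and {2,4,8} = 8.{1,5,7}, recomputed this session). An isogeny of CURVE Jacobians is a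
divisor D on C_1 x C_2 (Lefschetz
(1,1): existence unconditional) — here C_1: w^9 = X^4(1-X)^2 (genus 3), C_2: w^9 = X(1-X)^4 (genus
4), superelliptic, so D can
be COMPUTED AND CERTIFIED (rigorous periods arXiv:1707.07249; divisor certificates with exact
tangent action arXiv:1705.09248), and a
divisor acts on real integrals through its two FINITE projections: sheets = rule 2 (one per sheet,
sheets land on different arcs;
constant-multiplicity pushforwards are route MultivaluedCoV's SheetTransfer 2877), trace =
additivity, D^*omega - c.omega' = dF with F
ALGEBRAIC = rule 3 inside the class, homologies = Green with the closed form's own algebraic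
coefficients. No transcendental
primitive, no Gamma, no surface, no regularisation. Catalogue entry: geometric/motivic lift made
explicit as a certificate; certified
numerics to check every value (1e-14) and, for crux 2, to FIND the certificate.
RANKED CRUXES. (2) IsogenyLinearNinth — the bet and kill switch: B(5/9,7/9)-rep ~
(8/3)3^{1/6}sin(pi/9).B(8/9,5/9)-rep; first
non-graph correspondence to be compiled in the tree; with the supports it settles 0312 and falsifies
Neg 0311. (3) BetaLinearSector —
Conjecture 1 for (beta rep, algebraic multiple of a beta rep), all levels N: every Koblitz–Rohrlich
coincidence hH = H' as a compiled
correspondence (K–R Thms 3–4: infinite non-obvious families). (4) BetaProductSector — Conjecture 1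
for products of two beta reps
(dimension 2): plan = (3) x Dirichlet chaining x reflection; principled failure locus = Das2000
2-torsion. Sector = (3) ∧ (4).
Supports (rank 9, provable now): DirichletNinth; ReflectionNinth (= CompiledSubstitutions'
EulerReflectionRational 3383 at a = 1/9,
also needed by TerasomaCovering's glue 3600); TriplicationAccessible (= 0312, attached by signature;
shared with Neg, MultivaluedCoV,
TerasomaCovering); TriplicationGlue ((2) -> Dirichlet -> Reflection -> 0312 via KZProductIdeal's
PROVED Equivalent.prod / ideal /
reindex and scaling by an algebraic constant = product with a 0-dim rep). (5) FermatSectorComplete —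
RELATIVE COMPLETENESS of the KZ calculus modulo the beta sector: any two rational representations
with equal value are connected once the beta-sector pairs are granted as extra axioms ([r] − [r'] ∈
relations ⊔ closure(S_lin ∪ S_prod)); the off-sector complement of the summit, ranked LAST because
this line's CM-isogeny mechanism reaches only the sector while the statement is GPC-strength
(strength barriers apply in full); it is contentful on its own (not vacuous if (3) or (4) dies),
implied by the summit, and with (3),(4) it IS the summit — the deciding theorem `closes` (h₃ :
BetaLinearSector) (h₄ : BetaProductSector) (h₅ : FermatSectorComplete) : KontsevichZagierPeriods is
sup_le le_rfl (closure_le.2 ⟨S_lin ↦ h₃, S_prod ↦ h₄⟩) applied to h₅ (planner Sketch.lean rc 0, std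
axioms); Assembly := BetaLinearSector → BetaProductSector → FermatSectorComplete →
KontsevichZagierPeriods is its statement (provable now). Approaches to (5): (A1) the summit-wide
kernel-form mechanisms (routes NoriTransfer, Grothendieck, MotivatedMoves' motivated transfer) — the
same statement shape is the complement crux of the sibling sector routes
(MotivatedMoves.GammaSectorComplete, GammaCornerAnomaly.MUMSectorComplete), so one proof serves all;
(A2) tenure-time SHRINKING as sibling sector theorems T land (FermatSectorComplete ⇐ completeness
modulo S ∪ T, plus T-pairs ≤ relations — a glued split filed only then); (A3) in print the nearest
theorems decide WHICH relations exist, not chains of moves: HuberWustholz2022 (1-periods), Ayoub2015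
(relative version). Thesis X = (3) ∧ (4) ∧ (5), no separate target decl (route-choice 2026-08-16
option (a): the rev-2–4 bare implication SummitOffFermatSector and the sector-only target
FermatSectorThesis = (3) ∧ (4) are dropped; the sector theorem keeps its two named decls).
RELATION TO ROUTES OPENED TODAY. TerasomaCovering decomposes the SAME 0312 through the n = 3
multiplication formula for all s
(Terasoma's covering of SURFACES, a 3-chain in R^8); this route through the s = 1/9-specific LINEAR
relation (a curve correspondence,
2-chains in R^4) — an alternative decomposition sharing the decl, as D-0019 prescribes.
MultivaluedCoV supplies the sheet engine and
elliptic rungs; CompiledSubstitutions the reflection family; none states the linearisation or the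
Fermat-sector targets (3),(4).
KILL CRITERIA. Refutation of (2) (a Neg-0313 additive invariant separating the (i)-pair) closes the
route — and refutes the summit,
the pair having equal values. (2) certified but the divisor's action cannot be compiled (a side
condition of rule 2/3 provably unmet
on every cell decomposition) => report to operator as a calculus defect. No explicit D for some K–R
family => (3) becomes
conditional; route narrows to N = 9. A Das-type length-4 product identity with no linear+Dirichlet
derivation => (4)'s plan dies;
file that pair as the successor Neg test. If TerasomaCovering proves 0312 first, this route is not
superseded ((2),(3),(4) are
different statements) but goes dormant unless (2)/(3) move. Refutation of (5) is a refutation of the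
summit OFF the beta sector (route Neg's programme: a move-invariant of FormalRep vanishing on the
four move sets and separating one accessible off-sector pair, e.g. an MZV or elliptic-period
identity): it closes this route `refuted:FermatSectorComplete` and decides the summit negatively;
(2),(3),(4) survive as statements (shared decls). A proof of the summit by any kernel-form route
supersedes (5) and leaves (2)–(4) as this route's deliverable.
NOT DECOMPOSED YET. (2)'s certificate = {explicit D (CMSV computation, or Aoki1987's cycle of
character (1,4,7,6) pulled back;
acq-02211/02229); de Rham identity D^*omega_{5,7} = c.omega_{8,5} + dF in Q(zeta_9)(F_9); Betti
bookkeeping D_*gamma_0 ~ sum n_g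
g(gamma_0) mod boundaries and loops at the poles at infinity (second kind: NL + Green); complex arcs
as pairs of real reps} — a
glued split only after a grounder confirms D; (3),(4) untouched until (2) closes; general
DirichletChaining(a,b,c) left to the
first route that files it. MECHANISM DIVISION (not a statement division): the card's RB device
(Riemann bilinear by UN-NESTING) is run by route UnfoldedStokes (opened the same day:
UnfoldedStokesSquare, LegendreAllModuli, 0280) — same device, so no un-nesting ITEM is filed here,
while the statement coverage of this route is entire (cruxes 3, 4, 5 ⇒ KontsevichZagierPeriods by
`closes`); in the Fermat sector the duality relator
degenerates to Dirichlet re-association (B(1/3,1/3)B(2/3,2/3) = 2sqrt3.pi, Legendre-lemniscatic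
B(1/4,1/2)B(3/4,1/2) = 4pi chain). (5) is deliberately undecomposed: no split by period type (MZV /
elliptic / hypergeometric / exponential detours) is filed until a sibling sector theorem lands to
shrink it (A2 above); its direct Approaches live in the kernel-form routes.
CHEAPEST FALSIFIER. (i) RUN this session, passed: the unit-orbit bookkeeping behind crux 2 —
H_{1,4,4} = {1,5,7}, H_{5,7,6} =
{2,4,8} = 8.{1,5,7}; (5,7,6) ~ 2.(5,7,6) = (1,5,3) in [3,1,5] and (1,4,4) ~ 7.(1,4,4) = (7,1,1) in
[1,1,7], i.e. exactly the pair of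
KoblitzRohrlich1978 Thm 3 at N = 9; all five value identities to 1e-14; the quotient correspondence
through F_9 kills omega_{5,7}
(trace sum zeta^{5j} = 0), so D is genuinely non-graph. (ii) NEXT, cheapest kill of crux 2's carrier
(kit, ~1 h, not run): Molin–Neurohr
period matrices of C_1: w^9 = X^4(1-X)^2 and C_2: w^9 = X(1-X)^4 to 30 digits + LLL on Hom(J(C_1),
J(C_2)): rank 0 would contradict
K–R and kill the isogeny reading (prediction: rank 6 = [Q(zeta_9):Q], onto the new part). (iii)
Lookup for crux 4's plan: Das2000's
tables — a LENGTH-4 algebraic Gamma-monomial outside the Z-span of the standard relations at some N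
<= 36 hands the plan its obstruction
instance at once (the statement itself dies only with the summit). (iv) Crux 5 has no falsifier
cheaper than route Neg's invariant hunt (Neg-0313 family) run on an OFF-sector pair; from print none
is expected (HuberWustholz2022: every Q̄-linear relation of 1-periods is motivic; Ayoub2015: the
relative version of the conjecture is a theorem), and the strength barriers say a proof must carry
the algebraic independence of odd zeta values — so refuter vetting, not proving, is the first
staffing of (5).
Sources: KontsevichZagier2001; KoblitzRohrlich1978 (READ pp.1184-1186); Gross1978;
WolfartWustholz1985 (acq-02222); HuberWustholz2022;
Deligne1982HodgeCycles; Shioda1979; Aoki1987; Aoki1991; Das2000; AndrewsAskeyRoy1999;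
Waldschmidt2006; arXiv:1705.09248;
arXiv:1707.07249; arXiv:2402.06072; Ayoub2015; Ayoub2014; HuberMullerStachPeriods2017.

Novelty: NOVELTY (search-before-claim, this session 2026-08-15; searchd/OpenAlex/S2 down, zbMATH + Crossref +
galaxy + held texts used).
Queries: lit search --source zbmath "simple factors Jacobian Fermat curve Koblitz Rohrlich" (->
doi:10.4153/cjm-1978-099-6 READ as
paper:koblitz1978-simple-factors-jacobian-fermat-curve pp.1184-1186; doi:10.2307/2374786 Aoki1991,
acq-02229); "Werte der Betafunktion an
rationalen Stellen Wolfart Wüstholz" (-> doi:10.1007/bf01455911, acq-02222); "Aoki algebraic cycles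
Fermat varieties" (-> doi:10.2969/jmsj/03930385
Aoki1987, acq-02211; doi:10.1007/bf01458703 Aoki 1983); "algebraic gamma monomials double coverings
Das" (-> doi:10.1090/s0002-9947-00-02417-x);
lit search --source crossref "Hodge cycles Fermat surface explicit curves degree divisible by 3";
lit galaxy search --star all "Kontsevich-Zagier",
--star pdf "simple factors in the Jacobian of a Fermat curve", "beta function at rational" (0
relevant hits); in-tree: the six route files of the
sub-problem, negatives index (empty), and the sibling cards terasoma-covering-gauss-multiplication,
correspondences-as-multivalued-cov,
legendre-lemniscatic-dirichlet-certificate, unfolding-abelian-integrals-riemann-bilinear,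
integral-domain-roots-of-identities, compiling-substitutions-unfolded-angles.
Nearest prior art FOUND: (1) KoblitzRohrlich1978 p.1184 (hH_{r,s} = H_{r',s'} => identical lattices;
Shimura–Taniyama criterion) and Thm 3
(N = 3^n: the only non-obvious isogenies; at N = 9 exactly L_{1,1,7} ~ L_  [refs: 10.4153/cjm-1978-099-6, 10.2307/2374786, 10.1007/bf01455911, 10.2969/jmsj/03930385, 10.1007/bf01458703, 10.1090/s0002-9947-00-02417-x, 2402.06072, 1705.09248, 1707.07249, doi:10.4153/cjm-1978-099-6, paper:koblitz1978-simple-factors-jacobian-fermat-curve, doi:10.2307/2374786, doi:10.1007/bf01455911, doi:10.2969/jmsj/03930385, doi:10.1007/bf01458703, doi:10.1090/s0002-9947-00-02417-x, Aoki1991, Aoki]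

Barriers (technique_class: correspondence-transfer cm-isogeny dirichlet-chaining): BARRIERS (catalogue Literature/Barriers/KontsevichZagierPeriods: 4 files, 6 tagged declarations;
technique_class of this route: correspondence-transfer cm-isogeny dirichlet-chaining).
- Literature.Barriers.KontsevichZagierPeriods.noSemialgebraicPrimitive_inv_sub_two
[primitive-elimination, fibrewise-newton-leibniz]: NOT met. No variable is integrated out with a
primitive OF THE INTEGRAND: the only Newton–Leibniz primitives are given algebraic functions —
(1-t)^{4/9}-type monomial primitives in DirichletNinth, the rational function F of the exact form
D^*omega - c.omega' = dF on F_9 in IsogenyLinearNinth, and the coefficients themselves in Green's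
formula for CLOSED algebraic 1-forms (zero bulk). This route makes no use of the transcendental
abelian integral of the card's RB device (where un-nesting would be the evasion); its statement
coverage is nonetheless the whole of KontsevichZagierPeriods (cruxes 3, 4, 5, deciding theorem
`closes`).
- Literature.Barriers.KontsevichZagierPeriods.kzConjecture_implies_oddZetaAlgIndep
[strength-barrier, all-techniques]: MET HEAD-ON by crux 5 FermatSectorComplete and NOT evaded — with
cruxes 3–4 it is the summit (deciding theorem `closes`), so any proof of crux 5 must carry the
algebraic independence of the odd zeta values (the beta axioms it is granted are CM/abelian
identities, the sector where the period conjecture is already a theorem in substance: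
HuberWustholz2022 Thm 13.3, Ayoub2014 Rem. 8). The bet of THIS line is confined to cruxes

History (route lifecycle, newest last):
- 2026-08-15T12:58:42Z · rev 1: restated Assembly (stmt-KontsevichZagierPeriods-3902) — route-repair (cone guardrail, rrepair-KontsevichZagierPeriods-Fermat-bc8cc4b7): restate Assembly 1:1 with the open core INLINED as the kernel form over KZCalcul (operator:999:3021386)
- 2026-08-15T16:13:54Z · rev 2: restated Assembly (stmt-KontsevichZagierPeriods-8537) — glue repair (rbadge g2): restate Assembly 1:1 so every hypothesis is a listed item — the inlined open core (kernel form, ≡ summit) is replaced by the new suppor (planner-rbadge-KontsevichZagierPeriods-FermatI-bc8cc4b7-g2-0)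
- 2026-08-16T02:17:47Z · AUTO-CRUX: 2 conjecture-grade item(s) promoted to crux (SummitOffFermatSector, FermatSectorThesis) — refuter vetting / tiering apply (operator:999:1362873)
- 2026-08-16T03:12:06Z · rev 5: restated Assembly (stmt-KontsevichZagierPeriods-10386) — route-choice (a) [rchoice e685ff56]: the off-sector complement becomes ONE claimed crux FermatSectorComplete (rank 5); drop SummitOffFermatSector + sector-only (planner-rchoice-KontsevichZagierPeriods-Fermat-e685ff56-0)
- 2026-08-16T03:12:06Z · rev 5: dropped SummitOffFermatSector, FermatSectorThesis — route-choice (a) [rchoice e685ff56]: the off-sector complement becomes ONE claimed crux FermatSectorComplete (rank 5); drop SummitOffFermatSector + sector-only (planner-rchoice-KontsevichZagierPeriods-Fermat-e685ff56-0)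
- 2026-08-16T03:22:56Z · rev 6: dropped FermatSectorGlue — route-choice (a) rev-5 cleanup [rchoice e685ff56]: drop FermatSectorGlue (stmt-14242, filed 03:10Z by the parallel seat rchoice-7ad6caa6 against gate code route (planner-rchoice-KontsevichZagierPeriods-Fermat-e685ff56-0)
- 2026-08-25T07:13:51Z · DORMANT — reconciler: no traction for 7.5 d (last activity item-evidence-added at 2026-08-17T19:04:49Z); parked, not closed — `ledger route dormant route-KontsevichZagier (operator:999:13632)

sub-problem: KontsevichZagierPeriods · status: dormant · opened planner-plancard-KontsevichZagierPeriods-Kont-661df115-0 2026-08-15T11:25:41Z · rev 14 · ledger route-KontsevichZagierPeriods-FermatIsogeny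
GENERATED by the gate from the ledger (D-0016/17). Provers cite these decls: `theorem foo : Summit.KontsevichZagierPeriods.KontsevichZagierPeriods.Theses.FermatIsogeny.<Decl> := …` in Summits/KontsevichZagierPeriods/KontsevichZagierPeriods/Theorems/<Name>.lean.
-/

namespace Summit.KontsevichZagierPeriods.KontsevichZagierPeriods.Theses.FermatIsogeny

open scoped BigOperators Topology Manifold Classical MeasureTheory ProbabilityTheory Matrix InnerProductSpace ComplexConjugate ContinuousMap
open Filter Set Function TopologicalSpace MeasureTheory

attribute [summit_statement] _root_.KontsevichZagierPeriods

open Literature Periods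

/-- item stmt-KontsevichZagierPeriods-3896 · crux · rank 2 · open · by planner
why it might fail: No explicit divisor for the K–R isogeny L_{1,1,7}~L_{3,1,5} of J(F_9) is in print: it must be computed and certified (CMSV-style, genus 3/4, possibly of large degree), its de Rham/Betti action compiled; exact-form corrections have poles at infinity; a Neg-0313 invariant could separate the pair.
sources: KoblitzRohrlich1978, Aoki1987, Aoki1991, Gross1978, Deligne1982HodgeCycles, Shioda1979
[crux] TRI(i), the bet and kill switch of the route. r = ∫_0^1 x^{-4/9}(1-x)^{-2/9} dx = B(5/9,7/9)
= 2.1334131002548; r' = c·∫_0^1 x^{-1/9}(1-x)^{-4/9} dx = c·B(8/9,5/9) with c =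
(8/3)·3^{1/6}·sin(π/9) = 1.0953190120917 (real algebraic, inside the integrand); equality of values
(checked to 1e-15) is EQUIVALENT to Gauss multiplication Γ(1/9)Γ(4/9)Γ(7/9) = 2π·3^{1/6}Γ(1/3) given
reflection, i.e. it carries the whole transcendental content of the triplication pair 0312 (the rest
is DirichletNinth + ReflectionNinth, supports). Geometric origin: the periods are 9∫_{γ_0} ω_{5,7}
and 9∫_{γ_0} ω_{8,5} on the Fermat curve F_9 (ω_{r,s} = x^{r-1}y^{s-9}dx, γ_0 the real arc; both
forms of the second kind, poles only at the 9 points at infinity); ω_{5,7} lies on the factor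
L_{5,7,6} ~ L_{3,1,5}, ω_{8,5} on L_{8,5,5} = L_{1,4,4} ~ L_{1,1,7}; CM types H_{1,4,4} = {1,5,7},
H_{5,7,6} = {2,4,8} = 8·{1,5,7} (recomputed this session), so by KoblitzRohrlich1978 p.1184 the
lattices are identical and by Thm 3 (N = 3^n, n = 2, m = 0) this is THE unique non-obvious isogeny
of J(F_9). An isogeny of curve Jacobians is a divisor D on F_9 × F_9 (Lefschetz (1,1); explicit
candidates: Aoki1987 cycles for 3 | N -/
@[route_item "route-KontsevichZagierPeriods-FermatIsogeny"]
def IsogenyLinearNinth : Prop :=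
  ∀ (r r' : Literature.NumberTheory.Transcendental.KZ.IntegralRep 1), r.domain = {x | x 0 ∈ Set.Ioo (0:ℝ) 1} → Set.EqOn r.integrand (fun x => (x 0) ^ (-(4:ℝ)/9) * (1 - x 0) ^ (-(2:ℝ)/9)) r.domain → r'.domain = {x | x 0 ∈ Set.Ioo (0:ℝ) 1} → Set.EqOn r'.integrand (fun x => (8/3 : ℝ) * (3:ℝ) ^ ((1:ℝ)/6) * Real.sin (Real.pi / 9) * (x 0) ^ (-(1:ℝ)/9) * (1 - x 0) ^ (-(4:ℝ)/9)) r'.domain → Literature.NumberTheory.Transcendental.KZ.Equivalent r r'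

/-- item stmt-KontsevichZagierPeriods-3897 · crux · rank 3 · open · by planner
why it might fail: Needs EVERY Koblitz–Rohrlich coincidence hH=H' (infinite families at N=3^n, 2^n, Thms 3–4) realised by an explicit correspondence that compiles, uniformly in N; no explicit cycles are printed beyond Aoki's partial lists, and a single non-compilable isogeny relation refutes it (and the summit).
sources: KoblitzRohrlich1978, WolfartWustholz1985, HuberWustholz2022, Gross1978, Aoki1991
[crux] Conjecture 1 on the beta-LINEAR sector (all levels N at once): if B(a,b) = c·B(a',b') with c
real algebraic (a,b,a',b' positive rationals) then the two 1-dim reps are KZ-equivalent. A sub-case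
of KZPeriodConjecture' (so implied by the summit; c ≤ 0 or non-matching c make the hypothesis
vacuous). Numerically the sector is DECIDED: by WolfartWustholz1985 (Wüstholz's analytic subgroup
theorem on the CM factors of J(F_N); cf. HuberWustholz2022: every Q̄-linear relation among 1-periods
is motivic) the Q̄-linear relations among beta values at rational points are exactly the
proportionalities inside one Koblitz–Rohrlich class hH_{r,s,t} = H_{r',s',t'} (KoblitzRohrlich1978
p.1184; Thms 1–4 list the non-obvious classes: none for (N,6) = 1, infinite families for N = 3^n,
2^n), together with the 'obvious' ones (unit multiples = automorphisms (x,y) ↦ (ζ^i x, ζ^j y) and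
S_3, realised by rule 2; translations r ↦ r + N = integration by parts = rule 3 with monomial
primitive; reflection pairs = the d ≤ 1 rational sector). So the H21-specific content is: every K–R
coincidence is realised by an EXPLICIT divisor on F_N × F_N whose action compiles into moves (sheets
+ exact algebraic forms + Gr -/
@[route_item "route-KontsevichZagierPeriods-FermatIsogeny", crux]
def BetaLinearSector : Prop :=
  ∀ (a b a' b' : ℚ) (c : ℝ), 0 < a → 0 < b → 0 < a' → 0 < b' → IsAlgebraic ℚ c → ∀ (r r' : Literature.NumberTheory.Transcendental.KZ.IntegralRep 1), r.domain = {x | x 0 ∈ Set.Ioo (0:ℝ) 1} → Set.EqOn r.integrand (fun x => (x 0) ^ ((a:ℝ) - 1) * (1 - x 0) ^ ((b:ℝ) - 1)) r.domain → r'.domain = {x | x 0 ∈ Set.Ioo (0:ℝ) 1} → Set.EqOn r'.integrand (fun x => c * (x 0) ^ ((a':ℝ) - 1) * (1 - x 0) ^ ((b':ℝ) - 1)) r'.domain → r.value = r'.value → Literature.NumberTheory.Transcendental.KZ.Equivalent r r'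

/-- item stmt-KontsevichZagierPeriods-3898 · crux · rank 4 · open · by planner
why it might fail: Plan = linear sector x Dirichlet chaining x reflection; but Hodge-type Gamma-monomials are standard only over Q, not Z (Deligne–Koblitz–Ogus; Das2000 2-torsion): a length-4 product identity whose square alone is standard has no such derivation — new cycle needed, else a Neg witness.
sources: Das2000, Deligne1982HodgeCycles, AndrewsAskeyRoy1999, Waldschmidt2006, KoblitzRohrlich1978, arXiv:2402.06072
[crux] Conjecture 1 on the beta-PRODUCT sector (dimension 2): if B(a,b)B(e,d) = q·B(a',b')B(e',d')
with q real algebraic then the two product reps on (0,1)^2 are KZ-equivalent. Contains 'product =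
algebraic·π' pairs via π = B(1/2,1/2)·B(1,1) (the normalisation to a disc rep is the arcsine chain,
support-level), hence contains 0312 (Gauss triplication), Euler's lemniscate identity
B(1/4,1/2)B(3/4,1/2) = 4π (= Legendre at k^2 = 1/2, card legendre-lemniscatic-dirichlet-certificate)
and the F_3 duality relation B(1/3,1/3)B(2/3,2/3) = 2√3π. PLAN: BetaLinearSector ⊗ DirichletChaining
(B(a,b)B(a+b,c) = B(a,b+c)B(b,c): two rule-2 moves through the Dirichlet simplex,
AndrewsAskeyRoy1999 Thm 1.8.1 — in this sector the cup-product/duality relator IS the Fermat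
surface's simplex, so no Riemann-bilinear un-nesting is needed) ⊗ reflection ⊗ translation (rule 3
with monomial primitives), glued by KZProductIdeal (Equivalent.prod, ideal property, reindex — all
proved). Which identities exist is transcendence theory's business (Rohrlich–Lang conjecture,
Waldschmidt2006; Hodge-type criterion Deligne1982HodgeCycles §7); the H21 question is whether linear
+ Dirichlet + reflection GENERATE them as chain -/
@[route_item "route-KontsevichZagierPeriods-FermatIsogeny", crux]
def BetaProductSector : Prop :=
  ∀ (a b e d a' b' e' d' : ℚ) (q : ℝ), 0 < a → 0 < b → 0 < e → 0 < d → 0 < a' → 0 < b' → 0 < e' → 0 < d' → IsAlgebraic ℚ q → ∀ (r r' : Literature.NumberTheory.Transcendental.KZ.IntegralRep 2), r.domain = {x | ∀ i, x i ∈ Set.Ioo (0:ℝ) 1} → Set.EqOn r.integrand (fun x => (x 0) ^ ((a:ℝ) - 1) * (1 - x 0) ^ ((b:ℝ) - 1) * (x 1) ^ ((e:ℝ) - 1) * (1 - x 1) ^ ((d:ℝ) - 1)) r.domain → r'.domain = {x | ∀ i, x i ∈ Set.Ioo (0:ℝ) 1} → Set.EqOn r'.integrand (fun x => q * (x 0)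 ^ ((a':ℝ) - 1) * (1 - x 0) ^ ((b':ℝ) - 1) * (x 1) ^ ((e':ℝ) - 1) * (1 - x 1) ^ ((d':ℝ) - 1)) r'.domain → r.value = r'.value → Literature.NumberTheory.Transcendental.KZ.Equivalent r r'

/-- item stmt-KontsevichZagierPeriods-14252 · crux · rank 5 · open · by planner
why it might fail: With cruxes 3–4 it is the whole summit off the beta sector: false as soon as one accessible MZV, polylog or elliptic-period identity has a move-invariant obstruction (route Neg); GPC-strength (barrier kzConjecture_implies_oddZetaAlgIndep); no mechanism of this line reaches it.
sources: KontsevichZagier2001, HuberMullerStachPeriods2017, HuberWustholz2022, Ayoub2015, Ayoub2014, AyoubRelKZRevisited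
[crux] RELATIVE COMPLETENESS OF THE KZ CALCULUS MODULO THE FERMAT/BETA SECTOR — the off-sector
complement of the summit, carried by this route as its last-ranked crux so that the route
encompasses the entire summit (D-0027 §2.1; route-choice 2026-08-16, option (a)). Statement: any two
representations of KZ's §1.1 shape (IsRational) with equal value are connected in the calculus
ENLARGED by the beta-sector equivalences as extra axioms — [r] − [r'] ∈ relations ⊔ closure(S_lin ∪
S_prod), S_lin = the formal differences [ρ] − [ρ'] of the hypothesis pairs of BetaLinearSector
(1-dim beta rep, real-algebraic multiple of another, equal values), S_prod = those of
BetaProductSector (products of two beta reps on (0,1)^2), both inlined. Logical position (planner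
Sketch.lean rc 0, axioms propext/Classical.choice/Quot.sound): implied by the summit (relations ≤
relations ⊔ _, one line), hence never stronger than Kontsevich–Zagier Conjecture 1; CONTENTFUL on
its own — it does not become vacuous if crux 3 or 4 is refuted, unlike the bare implication
SummitOffFermatSector (= sector → summit) it replaces; and BetaLinearSector → BetaProductSector →
FermatSectorComplete → KontsevichZagierPeriods is the -/
@[route_item "route-KontsevichZagierPeriods-FermatIsogeny", crux]
def FermatSectorComplete : Prop :=
  ∀ ⦃n m : ℕ⦄ (r : Literature.NumberTheory.Transcendental.KZ.IntegralRep n) (r' : Literature.NumberTheory.Transcendental.KZ.IntegralRep m), r.IsRational → r'.IsRational → r.value = r'.value → Literature.NumberTheory.Transcendental.KZ.of r - Literature.NumberTheory.Transcendental.KZ.of r' ∈ Literature.NumberTheory.Transcendental.KZ.relations ⊔ AddSubgroup.closure ({z : Literature.NumberTheory.Transcendental.KZ.FormalRep | ∃ (a b a' b' : ℚ) (c : ℝ) (ρ ρ' : Literature.NumberTheory.Transcendental.KZ.IntegralRep 1), 0 < a ∧ 0 < b ∧ 0 < a' ∧ 0 < b' ∧ IsAlgebraic ℚ c ∧ ρ.domain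 = {x | x 0 ∈ Set.Ioo (0:ℝ) 1} ∧ Set.EqOn ρ.integrand (fun x => (x 0) ^ ((a:ℝ) - 1) * (1 - x 0) ^ ((b:ℝ) - 1)) ρ.domain ∧ ρ'.domain = {x | x 0 ∈ Set.Ioo (0:ℝ) 1} ∧ Set.EqOn ρ'.integrand (fun x => c * (x 0) ^ ((a':ℝ) - 1) * (1 - x 0) ^ ((b':ℝ) - 1)) ρ'.domain ∧ ρ.value = ρ'.value ∧ z = Literature.NumberTheory.Transcendental.KZ.of ρ - Literature.NumberTheory.Transcendental.KZ.of ρ'} ∪ {z : Literature.NumberTheory.Transcendental.KZ.FormalRep | ∃ (a b e d a' b' e' d' : ℚ) (q : ℝ) (ρ ρ' : Literature.NumberTheory.Transcendental.KZ.IntegralRep 2), 0 < a ∧ 0 < b ∧ 0 < e ∧ 0 < d ∧ 0 < a' ∧ 0 < b' ∧ 0 < e' ∧ 0 < d' ∧ IsAlgebraic ℚ q ∧ ρ.domain = {x | ∀ i, x i ∈ Set.Ioo (0:ℝ) 1} ∧ Set.EqOn ρ.integrand (fun x => (x 0) ^ ((a:ℝ) - 1) * (1 - x 0) ^ ((b:ℝ)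 - 1) * (x 1) ^ ((e:ℝ) - 1) * (1 - x 1) ^ ((d:ℝ) - 1)) ρ.domain ∧ ρ'.domain = {x | ∀ i, x i ∈ Set.Ioo (0:ℝ) 1} ∧ Set.EqOn ρ'.integrand (fun x => q * (x 0) ^ ((a':ℝ) - 1) * (1 - x 0) ^ ((b':ℝ) - 1) * (x 1) ^ ((e':ℝ) - 1) * (1 - x 1) ^ ((d':ℝ) - 1)) ρ'.domain ∧ ρ.value = ρ'.value ∧ z = Literature.NumberTheory.Transcendental.KZ.of ρ - Literature.NumberTheory.Transcendental.KZ.of ρ'})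

/-- item stmt-KontsevichZagierPeriods-0312 · support · rank 9 · open · by planner
sources: Deligne1982HodgeCycles, KontsevichZagier2001
Positive form of #2. A proof must avoid Γ: candidate strategy = realise the degree-9 Fermat-curve
correspondence behind the identity as semialgebraic changes of variables between (blow-ups of)
(0,1)² pieces plus Newton–Leibniz with algebraic primitives (Rohrlich/Deligne distribution relations
are induced by the maps x ↦ x³ on Fermat curves — algebraic, finite ⇒ CoV on injectivity cells). If
found, pressure point (b) of route Neg dies at its first instance. [elaborates: yes:
_survey/SketchB.lean; sources: Deligne1982HodgeCycles, KontsevichZagier2001] -/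
@[route_item "route-KontsevichZagierPeriods-FermatIsogeny"]
def TriplicationAccessible : Prop :=
  ∀ (r r' : Literature.NumberTheory.Transcendental.KZ.IntegralRep 2), r.domain = {x | ∀ i, x i ∈ Set.Ioo (0:ℝ) 1} → Set.EqOn r.integrand (fun x => (x 0) ^ (-(8:ℝ)/9) * (1 - x 0) ^ (-(5:ℝ)/9) * (x 1) ^ (-(4:ℝ)/9) * (1 - x 1) ^ (-(2:ℝ)/9)) r.domain → r'.domain = {x | x 0 ^ 2 + x 1 ^ 2 < 4} → Set.EqOn r'.integrand (fun _ => (3:ℝ) ^ ((7:ℝ)/6) / 2) r'.domain → Literature.NumberTheory.Transcendental.KZ.Equivalent r r'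

/-- item stmt-KontsevichZagierPeriods-3899 · support · rank 9 · closed · proved by Summit.KontsevichZagierPeriods.KontsevichZagierPeriods.Theorems.dirichletNinth_proof @ ba317947dfd2 (prover) · by planner
sources: AndrewsAskeyRoy1999, KontsevichZagier2001
[support] TRI(ii), Dirichlet re-association: B(1/9,4/9)·B(8/9,5/9) = 20.667155454193 =
(9/4)·B(1/9,8/9). Paper chain (5–6 move instances, every intermediate algebraic and absolutely
convergent, exponents > -1): flip y ↦ 1-y (rule 2) to present the second factor as B(5/9,8/9);
Dirichlet CoV (s,t) ↦ (st,(1-s)t) on (0,1)^2 (injective, polynomial, Jacobian t, image the open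
simplex) turns s^{-8/9}(1-s)^{-5/9}·t^{-4/9}(1-t)^{-1/9} into x^{-8/9} y^{-5/9} (1-x-y)^{-1/9} (a =
1/9, b = 4/9, a+b = 5/9, c = 8/9); affine involution (x,y) ↦ (x,1-x-y) of the simplex (Jacobian 1)
swaps the roles of b and c; inverse Dirichlet CoV gives the product rep
s^{-8/9}(1-s)^{-1/9}·(1-t)^{-5/9} (a + c = 1 kills the t-power); Newton–Leibniz along t with
primitive F(s,t) = -(9/4)(1-t)^{4/9} s^{-8/9}(1-s)^{-1/9} (semialgebraic on the closed band,
continuous in t on [0,1], derivative the integrand on (0,1)) gives the base rep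
(9/4)s^{-8/9}(1-s)^{-1/9}; the null set (0,1)×{0,1} between open square and closed band is a
domainAddRel move. Same engine as card legendre-lemniscatic-dirichlet-certificate's
DirichletChaining (general (a,b,c) version may be filed there; dedup by signature). Sources:
AndrewsAskeyRoy1999 -/
@[route_item "route-KontsevichZagierPeriods-FermatIsogeny"]
def DirichletNinth : Prop :=
  ∀ (r : Literature.NumberTheory.Transcendental.KZ.IntegralRep 2) (r' : Literature.NumberTheory.Transcendental.KZ.IntegralRep 1), r.domain = {x | ∀ i, x i ∈ Set.Ioo (0:ℝ) 1} → Set.EqOn r.integrand (fun x => (x 0) ^ (-(8:ℝ)/9) * (1 - x 0) ^ (-(5:ℝ)/9) * (x 1) ^ (-(1:ℝ)/9) * (1 - x 1) ^ (-(4:ℝ)/9)) r.domain → r'.domain = {x | x 0 ∈ Set.Ioo (0:ℝ) 1} → Set.EqOn r'.integrand (fun x => (9/4 : ℝ) * (x 0) ^ (-(8:ℝ)/9) * (1 - x 0) ^ (-(1:ℝ)/9)) r'.domain → Literature.NumberTheory.Transcendental.KZ.Equivalent r r'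

/-- item stmt-KontsevichZagierPeriods-3900 · support · rank 9 · closed · proved by Summit.KontsevichZagierPeriods.KontsevichZagierPeriods.Theorems.reflectionNinth_proof @ 3c3867751c78 (prover) · by planner
sources: AndrewsAskeyRoy1999, KontsevichZagier2001
[support] Reflection at 1/9: sin(π/9)·B(1/9,8/9) = π (B(1/9,8/9) = π/sin(π/9) = 9.1854024240859) as
a KZ chain from ∫_0^1 sin(π/9)·x^{-8/9}(1-x)^{-1/9} dx to the closed unit disc with integrand 1 —
LITERALLY the instance a = 1/9 of route CompiledSubstitutions' crux EulerReflectionRational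
(stmt-KontsevichZagierPeriods-3383, ∀ rational a ∈ (0,1)); filed as the explicit instance so that
the 0312 certificate does not wait on the ∀a theorem (whose log-cancellation step may need
Baker-type bookkeeping in general), and it follows from 3383 in one line once that lands (casts
((1/9 : ℚ) : ℝ) - 1 = -8/9, -(1/9) = -1/9 by push_cast/norm_num inside the EqOn hypotheses). Also
needed by route TerasomaCovering's glue 3600 (reflection value at 1/9). Paper chain: x = u/(1+u)
then u = v^9 (rule 2) give ∫_0^∞ 9 sin(π/9) dv/(1+v^9), a RATIONAL-times-algebraic 1-dim rep; fold
(1,∞) onto (0,1) by v ↦ 1/v BEFORE partial fractions (all pieces of 9/(1+v^9), 9v^7/(1+v^9) are then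
bounded on (0,1), hence absolutely integrable one by one); integrand additivity into real partial
fractions over Q(cos(π/9)); the log-type pieces cancel pairwise by the symmetry θ_j ↔ θ_{q+1-j}
(equal arguments — only trivial mult -/
@[route_item "route-KontsevichZagierPeriods-FermatIsogeny"]
def ReflectionNinth : Prop :=
  ∀ (r : Literature.NumberTheory.Transcendental.KZ.IntegralRep 1) (p : Literature.NumberTheory.Transcendental.KZ.IntegralRep 2), r.domain = {x | x 0 ∈ Set.Ioo (0:ℝ) 1} → Set.EqOn r.integrand (fun x => Real.sin (Real.pi / 9) * (x 0) ^ (-(8:ℝ)/9) * (1 - x 0) ^ (-(1:ℝ)/9)) r.domain → p.domain = {z | z 0 ^ 2 + z 1 ^ 2 ≤ 1} → Set.EqOn p.integrand (fun _ => 1) p.domain → Literature.NumberTheory.Transcendental.KZ.Equivalent r p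

/-- item stmt-KontsevichZagierPeriods-3901 · support · rank 9 · closed · proved by Summit.KontsevichZagierPeriods.KontsevichZagierPeriods.Theorems.triplicationGlue_proof @ 0a49b28ae05e (prover) · by planner
sources: KontsevichZagier2001
[support] Glue of the 0312 certificate, provable now from PROVED cone facts (KZProductIdeal.lean:
Equivalent.prod, mul_mem_relations_left_holds / mul_mem_relations_right_holds,
of_sub_of_reindex_mem_relations, prodFunSemialgebraic_holds; KZCalculus: Equivalent.refl/symm/trans,
the four *_subset_relations). Steps: (1) reps with the same domain and EqOn integrands are
equivalent (integrandAddRel with a zero rep), so fix convenient representatives; (2)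
IsogenyLinearNinth ⊗ [x^{-8/9}(1-x)^{-5/9}] (Equivalent.prod + reindex Fin (1+1) ≃ Fin 2): r_0312 ~
[x^{-8/9}(1-x)^{-5/9} · c·y^{-1/9}(1-y)^{-4/9}], c = (8/3)3^{1/6} sin(π/9); (3) SCALING LEMMA: [r_1]
- [r_2] ∈ relations ⇒ [k·r_1] - [k·r_2] ∈ relations for a real algebraic constant k (product with
the 0-dimensional rep of value k + ideal property + reindex Fin (0+n) ≃ Fin n), applied to
DirichletNinth (k = c) and to ReflectionNinth (k = 9c/(4 sin(π/9)) = 6·3^{1/6} = 2·3^{7/6}); (4)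
transitivity: r_0312 ~ [(9c/4) x^{-8/9}(1-x)^{-1/9}] ~ [closed unit disc, 2·3^{7/6}]; (5)
normalisation to the literal right-hand side of 0312: CoV z ↦ 2z (rule 2, |det| = 4) gives [closed
disc of radius 2, 3^{7/6}/2], and the boundary circle is a null set (d -/
@[route_item "route-KontsevichZagierPeriods-FermatIsogeny"]
def TriplicationGlue : Prop :=
  IsogenyLinearNinth → DirichletNinth → ReflectionNinth → TriplicationAccessible

-- earlier Assembly (stmt-KontsevichZagierPeriods-10386, replaced 2026-08-16T03:12:06Z -> stmt-KontsevichZagierPeriods-14251): retired by None — IsogenyLinearNinth → BetaLinearSector → BetaProductSector → SummitOffFermatSector → KontsevichZagierPeriods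
-- earlier Assembly (stmt-KontsevichZagierPeriods-3902, replaced 2026-08-15T12:58:42Z -> stmt-KontsevichZagierPeriods-8537): retired by None — IsogenyLinearNinth → BetaLinearSector → BetaProductSector → Literature.NumberTheory.Transcendental.KZKernelConjecture → KontsevichZagierPeriods
-- earlier Assembly (stmt-KontsevichZagierPeriods-8537, replaced 2026-08-15T16:13:54Z -> stmt-KontsevichZagierPeriods-10386): retired by None — IsogenyLinearNinth → BetaLinearSector → BetaProductSector → (∀ c : Literature.NumberTheory.Transcendental.KZ.FormalRep, Literature.NumberTheory.Transcendental.KZ.eval c = 0 → c ∈ Literature.NumberTheory.Transcendental.KZ.relations) → KontsevichZagierPeriods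
/-- item stmt-KontsevichZagierPeriods-14251 · assembly · rank 1 · closed · proved by Summit.KontsevichZagierPeriods.FermatIsogeny.assembly_proof (prover) · by planner
sources: KontsevichZagier2001, HuberMullerStach2017
[assembly] BetaLinearSector → BetaProductSector → FermatSectorComplete → KontsevichZagierPeriods —
literally the statement of the deciding theorem `closes` (rev 5, route-choice (a) 2026-08-16): the
two sector cruxes put every generator of S_lin ∪ S_prod inside KZ.relations, so KZ.relations ⊔
AddSubgroup.closure (S_lin ∪ S_prod) ≤ KZ.relations (sup_le le_rfl (closure_le.2 …)), and the
membership given by FermatSectorComplete for rational r, r' of equal value is KZ.Equivalent r r'.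
PROVABLE NOW — proof = the body of `closes` in this file, verbatim (planner Sketch.lean rc 0, axioms
propext/Classical.choice/Quot.sound): `intro h₃ h₄ h₅ n m r r' hr hr' hv; refine (sup_le le_rfl
((AddSubgroup.closure_le _).mpr ?_)) (h₅ r r' hr hr' hv); rintro z (⟨a, b, a', b', c, ρ, ρ', ha, hb,
ha', hb', hc, hd, hi, hd', hi', hval, rfl⟩ | ⟨a, b, e, d, a', b', e', d', q, ρ, ρ', ha, hb, he, hdd,
ha', hb', he', hd'', hq, hd, hi, hd', hi', hval, rfl⟩); · exact h₃ a b a' b' c ha hb ha' hb' hc ρ ρ'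
hd hi hd' hi' hval; · exact h₄ a b e d a' b' e' d' q ha hb he hdd ha' hb' he' hd'' hq ρ ρ' hd hi hd'
hi' hval`. Replaces the rev-2–4 Assembly IsogenyLinearNinth → BetaLinearSector → BetaProductSector →
SummitOffFerm -/
@[route_item "route-KontsevichZagierPeriods-FermatIsogeny"]
def Assembly : Prop :=
  BetaLinearSector → BetaProductSector → FermatSectorComplete → KontsevichZagierPeriods

/-! D-0027 §2.1 — DECIDING THEOREM (planner-authored via `route open/edit --closes-file`; by planner-rchoice-KontsevichZagierPeriods-Fermat-e685ff56-0 2026-08-16T03:12:06Z):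
its hypotheses are this route's items and its conclusion the sub-problem Statement (glue_lint), and it elaborates with this file. -/

@[closes "route-KontsevichZagierPeriods-FermatIsogeny"] theorem closes (h₃ : BetaLinearSector) (h₄ : BetaProductSector) (h₅ : FermatSectorComplete) : KontsevichZagierPeriods := by
  intro n m r r' hr hr' hv
  refine (sup_le le_rfl ((AddSubgroup.closure_le _).mpr ?_)) (h₅ r r' hr hr' hv)
  rintro z (⟨a, b, a', b', c, ρ, ρ', ha, hb, ha', hb', hc, hd, hi, hd', hi', hval, rfl⟩ |
    ⟨a, b, e, d, a', b', e', d', q, ρ, ρ', ha, hb, he, hdd, ha', hb', he', hd'', hq, hd, hi, hd', hi', hval, rfl⟩)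
  · exact h₃ a b a' b' c ha hb ha' hb' hc ρ ρ' hd hi hd' hi' hval
  · exact h₄ a b e d a' b' e' d' q ha hb he hdd ha' hb' he' hd'' hq ρ ρ' hd hi hd' hi' hval

end Summit.KontsevichZagierPeriods.KontsevichZagierPeriods.Theses.FermatIsogeny
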